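import Summits.ValiantsHypothesis.ValiantsHypothesis.Theorems.BarrierLeverChowBenchmarkPairsDirichletInfinite

/-!
# Route BarrierLever — item 22038 `ChowBenchmarkPairs`, line `moore-peel`: EVERY positive integer Dirichlet parameter
# has infinitely many bad stages — `det G^{(α)}_i = 0` for `i = (2^{α+3} - 1)·2^j - 1`, `j ≥ α + 5`

Helper file (`--supports stmt-ValiantsHypothesis-22038`; cell valiant-natproofs, rung V4, 𝒟-side benchmark of
record, line `moore_peel`; seat val-np-p4 gen 27, memo `HOME/val-np-p4/g27/MEMO-valnp4-g27.md` §3).  Closes NO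
item.  No new definitions.

THE DICHOTOMY FOR THE DIRICHLET FAMILY OF THE PEEL (with `kernelPoisedAt_dirichletWeight` of `…DirichletRational`: every
NON-integer positive rational parameter is good at every height): for every INTEGER `α ≥ 1` the peel's stage matrices
`G^{(α)}_i` are singular at infinitely many stages, explicitly at `i = (2^{α+3} - 1)·2^j - 1` for all `j ≥ α + 5`
(`α = 1`: `15·2^j - 1`, `…DirichletInfinite`; `α = 2`: `31·2^j - 1` from `3967`; `α = 3`: `63·2^j - 1` from `16127`; …).
So CONJECTURE U of memo g26 («α = 1 is the unique bad positive rational parameter») fails for EVERY integer `α`, and the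
hierarchical Moore peel certifies Dirichlet(α,α) poisedness at all heights if and only if `α ∉ ℕ`.

THE CASCADE (THEOREM W; `A = 2^{α+2}`, `C = 2^{j-α-5}`, `P₁ = AC`, `P₂ = A²C`): `i = 16P₂ - 8P₁ - 1`,
`c_i = q·32P₂ + (8P₂ + 12P₁ + 2)` with `q = 4P₁(A-1) + (C-1) = 2^{j-1}(2^{α+2}-1) + (2^{j-α-5}-1)`, `|bits q| = j - 3`
(`det_dirichletWindow_shift'`, point `α ↦ α + j - 3`); flip at `16P₂` to `(8P₂ - 12P₁ - 2, 8P₁ + 1)`; `α + 1` lifts at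
`8P₁·2^{α+1}, …, 16P₁` (`det_dirichletWindow_lifts_eq_zero`, point `↦ j - 4`) down to `(4P₁ - 2, 8P₁ + 1)`; shift at `8P₁`
(point `↦ j - 3`) to the falling-factorial window `(4P₁ - 2, 1) = (2^{j-1} - 2, 1)`, which vanishes at `j - 3`
(`det_dirichletWindow_tail_eq_zero`).

* `card_bits_two_pow_mul_add`, `card_bits_two_pow_sub_one'`, `card_bits_intFamily` — the digit count `j - 3`.
* `det_dirichletWindow_lifts_eq_zero` — iterated rule (R3) above the code `2^b + 1`.
* **`det_kpeelMatrix_ascFactorial_intFamily`**, **`infinite_badStages_ascFactorial`** — the theorems.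

WHAT THIS IS NOT: nothing on the segment-mean stub itself (α = 1 is `…DirichletInfinite`), on crux
stmt-ValiantsHypothesis-14610 or on `VP` versus `VNP`.
-/

set_option linter.dupNamespace false

namespace Summit.ValiantsHypothesis.ValiantsHypothesis.Theorems.BarrierLever.MoorePeel

open Finset Matrix

/-! ## 1. Digit counts -/

/-- Digits of `2^u · y + x` (`x < 2^u`): the digits of `x` and the shifted digits of `y`. -/
theorem card_bits_two_pow_mul_add {u x : ℕ} (y : ℕ) (hx : x < 2 ^ u) :
    (bits (2 ^ u * y + x)).card = (bits x).card + (bits y).card := by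
  have e : bits (2 ^ u * y + x) = bits x ∪ (bits y).map (addRightEmbedding u) := by
    ext t
    rw [Finset.mem_union, Finset.mem_map, mem_bits, Nat.testBit_two_pow_mul_add _ hx]
    constructor
    · intro h
      by_cases ht : t < u
      · rw [if_pos ht] at h; exact Or.inl (mem_bits.mpr h)
      · rw [if_neg ht] at h
        exact Or.inr ⟨t - u, mem_bits.mpr h, by simp only [addRightEmbedding_apply]; omega⟩
    · rintro (h | ⟨v, hv, rfl⟩)
      · have : t < u := lt_of_mem_bits hx h
        rw [if_pos this]; exact mem_bits.mp h
      · simp only [addRightEmbedding_apply]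
        rw [if_neg (by omega), Nat.add_sub_cancel]; exact mem_bits.mp hv
  rw [e, Finset.card_union_of_disjoint, Finset.card_map]
  rw [Finset.disjoint_left]
  intro t ht ht'
  obtain ⟨v, -, hv⟩ := Finset.mem_map.mp ht'
  have := lt_of_mem_bits hx ht
  simp only [addRightEmbedding_apply] at hv
  omega

/-- `|bits (2^v - 1)| = v`. -/
theorem card_bits_two_pow_sub_one' (v : ℕ) : (bits (2 ^ v - 1)).card = v := by
  have := bits_two_pow_sub_one_sub (a := 0) (k := v) Nat.one_le_two_pow
  rw [Nat.sub_zero, bits_zero, Finset.sdiff_empty] at this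
  rw [this, Finset.card_range]

/-- The digit count of the family: `|bits (2^{w+v+2}·(2^v - 1)·… )|`: for `q = 2^{u}(2^v - 1) + (2^w - 1)` with `w ≤ u`,
`|bits q| = v + w`. -/
theorem card_bits_intFamily {u v w : ℕ} (hw : w ≤ u) :
    (bits (2 ^ u * (2 ^ v - 1) + (2 ^ w - 1))).card = v + w := by
  rw [card_bits_two_pow_mul_add _ (lt_of_lt_of_le (Nat.sub_lt Nat.one_le_two_pow Nat.one_pos)
    (Nat.pow_le_pow_right (by norm_num) hw)), card_bits_two_pow_sub_one', card_bits_two_pow_sub_one', Nat.add_comm]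

/-! ## 2. Iterated lifts above the code `2^b + 1` -/

/-- Iterated rule (R3): with `B = 2^b` (the half of the code `c = 2B + 1`), the window
`(B - 2 + 4B(2^L - 1), 2B + 1)` at the point `y` inherits the vanishing of `(B - 2, 2B + 1)` at `y - L`. -/
theorem det_dirichletWindow_lifts_eq_zero (b : ℕ) (hb : 1 ≤ b) (L : ℕ) : ∀ (y : ℤ),
    (dirichletWindow (y - L) (2 ^ b - 2) (2 * 2 ^ b + 1)).det = 0 →
    (dirichletWindow y (2 ^ b - 2 + 4 * 2 ^ b * (2 ^ L - 1)) (2 * 2 ^ b + 1)).det = 0 := by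
  induction L with
  | zero => intro y h; simpa using h
  | succ L ih =>
    intro y h
    have hB : 2 ≤ 2 ^ b := by
      calc (2 : ℕ) = 2 ^ 1 := by norm_num
        _ ≤ 2 ^ b := Nat.pow_le_pow_right (by norm_num) hb
    set T := 2 ^ b * 2 ^ L with hT
    have hT1 : 2 ^ b ≤ T := by rw [hT]; exact Nat.le_mul_of_pos_right _ Nat.one_le_two_pow
    have hk : 2 ^ (b + L + 2) = 4 * T := by rw [hT, pow_add, pow_add]; ring
    have hL1 : 2 ^ (L + 1) = 2 * 2 ^ L := by rw [pow_succ]; ring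
    have e4 : 4 * 2 ^ b * (2 ^ L - 1) = 4 * T - 4 * 2 ^ b := by
      rw [Nat.mul_sub, show 4 * 2 ^ b * 2 ^ L = 4 * T by rw [hT]; ring]; omega
    have e8 : 4 * 2 ^ b * (2 ^ (L + 1) - 1) = 8 * T - 4 * 2 ^ b := by
      rw [Nat.mul_sub, hL1, show 4 * 2 ^ b * (2 * 2 ^ L) = 8 * T by rw [hT]; ring]; omega
    obtain ⟨ε, hε⟩ := det_dirichletWindow_lift y (k := b + L + 2) (c := 2 * 2 ^ b + 1)
      (n := 4 * T - 2 * 2 ^ b - 1) (i := 2 ^ b - 2 + 4 * 2 ^ b * (2 ^ L - 1))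
      (by rw [hk]; omega) (by rw [e4]; omega)
    have e : 4 * T - 2 * 2 ^ b - 1 + (2 * 2 ^ b + 1) + (2 ^ b - 2 + 4 * 2 ^ b * (2 ^ L - 1)) =
        2 ^ b - 2 + 4 * 2 ^ b * (2 ^ (L + 1) - 1) := by
      rw [e4, e8]; omega
    rw [e] at hε
    rw [hε, ih (y - 1) (by rw [show y - 1 - (L : ℤ) = y - ((L + 1 : ℕ) : ℤ) by push_cast; ring]; exact h)]
    ring

/-! ## 3. The family -/

section Family

/-- The window start of the family in the atoms `P₁ = AC`, `P₂ = A²C` (`A ≥ 2`, `C ≥ 1`):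
`c_i = (4P₁(A-1) + (C-1))·32P₂ + (8P₂ + 12P₁ + 2)` for `i = 16P₂ - 8P₁ - 1`. -/
theorem windowStart_intFamily (A C P₁ P₂ : ℕ) (hA : 2 ≤ A) (hC : 1 ≤ C) (hP₁ : P₁ = A * C)
    (hP₂ : P₂ = A * A * C) :
    windowStart (16 * P₂ - 8 * P₁ - 1) = (4 * P₁ * (A - 1) + (C - 1)) * (32 * P₂) + (8 * P₂ + 12 * P₁ + 2) := by
  have hP₂A : P₂ = A * P₁ := by rw [hP₂, hP₁, mul_assoc]
  have h1 : 1 ≤ P₁ := by rw [hP₁]; nlinarith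
  have h2 : 2 * P₁ ≤ P₂ := by rw [hP₂A]; exact Nat.mul_le_mul_right _ hA
  rw [windowStart, show 16 * P₂ - 8 * P₁ - 1 - 1 = 2 * (8 * P₂ - 4 * P₁ - 1) by omega,
    Nat.mul_div_assoc _ (Dvd.intro _ rfl), Nat.mul_div_cancel_left _ (by norm_num)]
  obtain ⟨A', rfl⟩ : ∃ A', A = A' + 1 := ⟨A - 1, by omega⟩
  obtain ⟨C', rfl⟩ : ∃ C', C = C' + 1 := ⟨C - 1, by omega⟩
  rw [show A' + 1 - 1 = A' by omega, show C' + 1 - 1 = C' by omega]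
  obtain ⟨Q, hQ⟩ : ∃ Q, 8 * P₂ - 4 * P₁ - 1 = Q := ⟨_, rfl⟩
  have hQ' : (Q : ℤ) = 8 * P₂ - 4 * P₁ - 1 := by omega
  rw [hQ, show 16 * P₂ - 8 * P₁ - 1 = 2 * Q + 1 by omega]
  subst hP₁ hP₂
  zify
  push_cast at hQ' ⊢
  linear_combination (2 * (Q : ℤ) + 2 * (8 * (((A' : ℤ) + 1) * ((A' : ℤ) + 1) * ((C' : ℤ) + 1)) -
    4 * (((A' : ℤ) + 1) * ((C' : ℤ) + 1)) - 1) + 1) * hQ'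

/-- **`det G^{(α)}_i = 0` for `i = (2^{α+3} - 1)·2^j - 1`, `j ≥ α + 5`, `α ≥ 1`.** -/
theorem det_kpeelMatrix_ascFactorial_intFamily (α j : ℕ) (hα : 1 ≤ α) (hj : α + 5 ≤ j) :
    (kpeelMatrix (Nat.ascFactorial α) ((2 ^ (α + 3) - 1) * 2 ^ j - 1)).det = 0 := by
  obtain ⟨j', rfl⟩ : ∃ j', j = j' + (α + 5) := ⟨j - (α + 5), by omega⟩
  set A := 2 ^ (α + 2) with hA
  set C := 2 ^ j' with hC
  have hA8 : 8 ≤ A := by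
    rw [hA]; calc (8 : ℕ) = 2 ^ 3 := by norm_num
      _ ≤ 2 ^ (α + 2) := Nat.pow_le_pow_right (by norm_num) (by omega)
  have hC1 : 1 ≤ C := Nat.one_le_two_pow
  set P₁ := A * C with hP₁
  set P₂ := A * A * C with hP₂
  have hP₂A : P₂ = A * P₁ := by rw [hP₂, hP₁, mul_assoc]
  have hP₁8 : 8 ≤ P₁ := by rw [hP₁]; nlinarith
  have hP₂8 : 8 * P₁ ≤ P₂ := by rw [hP₂A]; exact Nat.mul_le_mul_right _ hA8
  -- powers of two in the atoms
  have eA3 : 2 ^ (α + 3) = 2 * A := by rw [hA, pow_succ]; ring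
  have ej : 2 ^ (j' + (α + 5)) = 8 * P₁ := by rw [hP₁, hA, hC, pow_add, pow_add]; ring
  have ej1 : 2 ^ (j' + α + 4) = 4 * P₁ := by
    have : 2 ^ (j' + α + 4) * 2 = 2 ^ (j' + (α + 5)) := by rw [← pow_succ]; ring_nf
    omega
  have eTop : 2 ^ (j' + 2 * α + 9) = 32 * P₂ := by
    rw [hP₂, hA, hC, show j' + 2 * α + 9 = j' + (α + 2) + (α + 2) + 5 by ring, pow_add, pow_add, pow_add]; ring
  have eFlip : 2 ^ (j' + 2 * α + 8) = 16 * P₂ := by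
    have : 2 ^ (j' + 2 * α + 8) * 2 = 2 ^ (j' + 2 * α + 9) := by rw [← pow_succ]
    omega
  have eL : 16 * P₁ * 2 ^ (α + 1) = 8 * P₂ := by rw [hP₂, hP₁, hA, pow_succ]; ring
  have hmul : (2 * A - 1) * (8 * P₁) + 8 * P₁ = 16 * P₂ := by
    have e : (2 * A - 1) * (8 * P₁) + 1 * (8 * P₁) = (2 * A - 1 + 1) * (8 * P₁) := (Nat.add_mul _ _ _).symm
    rw [Nat.sub_add_cancel (by omega : 1 ≤ 2 * A), one_mul] at e
    rw [e, hP₂A]; ring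
  have hi : (2 ^ (α + 3) - 1) * 2 ^ (j' + (α + 5)) - 1 = 16 * P₂ - 8 * P₁ - 1 := by
    rw [eA3, ej]; omega
  rw [← dirichletWindow_natCast_windowStart, hi, windowStart_intFamily A C P₁ P₂ (by omega) hC1 hP₁ hP₂]
  -- Step 1: the block of `j - 3` high digits; point `α ↦ α + (α + 2 + j')`.
  have hq : 4 * P₁ * (A - 1) + (C - 1) = 2 ^ (j' + α + 4) * (2 ^ (α + 2) - 1) + (2 ^ j' - 1) := by
    rw [ej1, ← hA, ← hC]
  have s1 := det_dirichletWindow_shift' ((α : ℕ) : ℤ) (L := j' + 2 * α + 9) (r := 8 * P₂ + 12 * P₁ + 2)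
    (i := 16 * P₂ - 8 * P₁ - 1) (by rw [eTop]; omega) (4 * P₁ * (A - 1) + (C - 1))
  rw [eTop] at s1
  rw [s1, hq, card_bits_intFamily (by omega)]
  -- Step 2: the flip at `16 P₂`.
  obtain ⟨ε2, s2⟩ := det_dirichletWindow_flip (((α : ℕ) : ℤ) + ((α + 2 + j' : ℕ) : ℤ)) (k := j' + 2 * α + 8)
    (a := 8 * P₁ + 1) (s := 8 * P₂ + 4 * P₁ + 1) (n := 8 * P₂ - 12 * P₁ - 2) (by rw [eFlip]; omega)
  rw [show 8 * P₂ + 4 * P₁ + 1 + (8 * P₂ - 12 * P₁ - 2) = 16 * P₂ - 8 * P₁ - 1 by omega,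
    show 8 * P₁ + 1 + (8 * P₂ + 4 * P₁ + 1) = 8 * P₂ + 12 * P₁ + 2 by omega] at s2
  rw [s2]
  -- Step 3: `α + 1` lifts above the code `8P₁ + 1 = 2·(4P₁) + 1`; point `↦ α + j' + 1`.
  have hlift := det_dirichletWindow_lifts_eq_zero (j' + α + 4) (by omega) (α + 1)
    (((α : ℕ) : ℤ) + ((α + 2 + j' : ℕ) : ℤ))
  rw [ej1, show 4 * P₁ - 2 + 4 * (4 * P₁) * (2 ^ (α + 1) - 1) = 8 * P₂ - 12 * P₁ - 2 by
      rw [Nat.mul_sub, show 4 * (4 * P₁) * 2 ^ (α + 1) = 8 * P₂ by rw [← eL]; ring]; omega,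
    show 2 * (4 * P₁) + 1 = 8 * P₁ + 1 by ring] at hlift
  rw [hlift]
  · ring
  -- Step 4: the shift at `8 P₁ = 2^j`; Step 5: the falling-factorial window `(4P₁ - 2, 1)` at `α + j' + 2`.
  have s5 := det_dirichletWindow_shift (((α : ℕ) : ℤ) + ((α + 2 + j' : ℕ) : ℤ) - ((α + 1 : ℕ) : ℤ))
    (k := j' + (α + 5)) (r := 1) (i := 4 * P₁ - 2) (by rw [ej]; omega)
  rw [ej] at s5
  rw [s5]
  have s6 := det_dirichletWindow_tail_eq_zero (m := j' + α + 3) (N := 4 * P₁ - 2) (by omega)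
    (by rw [show j' + α + 3 + 1 = j' + α + 4 by ring, ej1]; omega)
  rw [show (((α : ℕ) : ℤ) + ((α + 2 + j' : ℕ) : ℤ) - ((α + 1 : ℕ) : ℤ) + 1) = ((j' + α + 3 : ℕ) : ℤ) - 1 by
    push_cast; ring, s6]
  ring

/-- **For every integer `α ≥ 1` the Dirichlet(α,α) stage matrices are singular at infinitely many stages.** -/
theorem infinite_badStages_ascFactorial (α : ℕ) (hα : 1 ≤ α) :
    Set.Infinite {i : ℕ | (kpeelMatrix (Nat.ascFactorial α) i).det = 0} := by
  have hinj : Function.Injective (fun j : ℕ => (2 ^ (α + 3) - 1) * 2 ^ (j + (α + 5)) - 1) := by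
    intro a b hab
    have h3 : 1 ≤ 2 ^ (α + 3) - 1 := by
      have : 2 ≤ 2 ^ (α + 3) := by
        calc (2:ℕ) = 2 ^ 1 := by norm_num
          _ ≤ 2 ^ (α + 3) := Nat.pow_le_pow_right (by norm_num) (by omega)
      omega
    have ha : 0 < (2 ^ (α + 3) - 1) * 2 ^ (a + (α + 5)) := Nat.mul_pos (by omega) (Nat.two_pow_pos _)
    have hb : 0 < (2 ^ (α + 3) - 1) * 2 ^ (b + (α + 5)) := Nat.mul_pos (by omega) (Nat.two_pow_pos _)
    have e : (2 ^ (α + 3) - 1) * 2 ^ (a + (α + 5)) = (2 ^ (α + 3) - 1) * 2 ^ (b + (α + 5)) := by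
      simp only at hab; omega
    have e2 := Nat.eq_of_mul_eq_mul_left (by omega) e
    have := Nat.pow_right_injective (le_refl 2) e2
    omega
  refine Set.infinite_of_injective_forall_mem hinj fun j => ?_
  exact det_kpeelMatrix_ascFactorial_intFamily α (j + (α + 5)) hα (by omega)

end Family

end Summit.ValiantsHypothesis.ValiantsHypothesis.Theorems.BarrierLever.MoorePeel
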